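import Summits.QuantumFields.YangMills.Theorems.UnitScaleTiltProp7CornerCombL1PropagationBoxes
import Summits.QuantumFields.YangMills.Theorems.UnitScaleTiltProp7CornerCombTiedSourceBoxes
import HarnessLib

/-!
# (n3)-COMB (II), row `hMcomb₂`, H2-1(E) member knit, file M-1 — THE ℓ¹ PROPAGATION OF A TIED SOURCE ON `ℤᵈ`: the straight box lifted to the finer field, the Λ boxes kept

Crux `stmt-QuantumFields-19200` `MinimiserStabilityRegPr`, route-R E′ (A′)-on-Σ, P-A2 (β); H2-1(E) (★px17 H-4b: `hMcomb₂ ⟸` per-(l, j) `ℓ¹` bounds of `P_{l←j+1}(s_j)` with TIED `s_j`);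
px18 g4 LOCATE `LOCATE-H21E-MEMBER-KNIT-px18g4.md` 2686e4bb §1 (1b)–(1d) (M-1; M-2 = px13 g7 «…H21ELambdaPricing»).  Width seat `ym3-torus-px18` (gen 4);
`--kind proof --supports stmt-QuantumFields-19200 --as helper`; THEOREMS ONLY; «(O2) groundwork»; count-neutral.  YM₃ on T³ is a ladder rung (R3), not Clay; nothing here is progress on
the YM mass gap.

## What is here
* (the RE-BASING letter of LOCATE (1b), `avgIter L V (a + b) = avgIter L (avgIter L V a) b`, which makes ★px17's H-4 propagator `P_{l←j+1}` an instance of ✓p704390's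
  `Q`-tower at `avgIter L U₀♯ (j+1)`, is ALREADY lit ✓`B9Eq315QTower.avgIter_add` ∕ ✓`B7Eq106Concrete.avgIter_add` — cite it, nothing restated here; px16 g8's read.)
* ★★★ `sum_norm_linTower_tied_le_boxes` — ✓`…CornerCombL1PropagationBoxes.sum_norm_linTower_le_boxes` for a source `s` TIED to the two-block `ℓ²` masses of a finer field `Ỹ`
  (`‖s y κ‖ ≤ Cs·M₂(y,κ)`, ✓H-3a's letter), with the STRAIGHT box lifted to `Ỹ` by ✓p713753 `sum_norm_tied_le_twoBlock_box`:
  `Σ_{z∈box c R}Σ_κ‖Q n s z κ‖ ≤ (Π_{m<n}w_m)·Cs·2d·Σ_{x∈box (L^{n+1}•c) (L·(Lⁿ(R+4)−4) + 2L)}Σ_ν‖Ỹ x ν‖² + d·L·Σ_{i<n}(Π_{m<i}w_m)·Σ_{z∈box c R}Σ_κ(Σ_{x∈box (Lⁿ•z) (ρᵢ)}Σ_μ‖s x μ‖ + Σ_{x∈box (Lⁿ•(z+e κ)) (ρᵢ)}Σ_μ‖s x μ‖)`,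
  `ρᵢ = Lⁱ(L+4) − 4` — the Λ boxes are LEFT for M-2's periodic pricing (px13 g7), the big box for M-3's periodic fold; zero twin with either.
DEPENDENCE: as in the two cited theorems; nothing reads `n` beyond the displayed products∕powers.  HONEST: bookkeeping; nothing of H2-1's member ∕ `hMcomb₂` ∕ `hMcomb` ∕ (β) ∕ the crux is
proved or claimed; rung R3 (YM₃ on T³), NOT d = 4, NOT Clay; YM gap NOT proved.  References: T. Bałaban, CMP 98 (1985) 17–51 [Balaban1985Averaging] ((42)–(43) pp.23–24, (124)–(126) p.36).
-/

set_option autoImplicit false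

noncomputable section

open scoped BigOperators
open Finset

namespace Summit.QuantumFields.YangMills.Theorems.Prop7CornerCombH21EPropagationTied

open NormedSpace
open Literature.MathematicalPhysics.QuantumFieldTheory.Balaban1983to89
open ExpMeanLog (eml)
open B7Prop1Explicit (Site Letter e seg treeWord boxVec gammaWord Wcx Xavg bavg expUnit U1)
open B7Prop2Explicit (avgIter unitaryUnits)
open B7Prop3GeneralRotated (tsum)
open B4Eq19LatticeOperators (box)
open Summit.QuantumFields.YangMills.Theorems.Prop7CornerCombL1PropagationBoxes (sum_norm_linTower_le_boxes smul_pow_smul)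
open Summit.QuantumFields.YangMills.Theorems.Prop7CornerCombTiedSourceBoxes (sum_norm_tied_le_twoBlock_box)

/-! ## The propagation of a tied source: straight box lifted, Λ boxes kept -/

section Tied

variable {d : ℕ} {𝔸 : Type*} [CStarAlgebra 𝔸] [Nontrivial 𝔸] {𝔅 : Type*} [SeminormedAddCommGroup 𝔅]

/-- ★★★ **THE ℓ¹ PROPAGATION OF A TIED SOURCE** (`2 ≤ L`): hypotheses of ✓`sum_norm_linTower_le_boxes` on the background tower (`Ūᵏ` unitary for `k ≤ n`, block loops `≤ α_k ≤ 1∕24`)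
and on the recursion of `Q`, a source `s` tied to the two-block `ℓ²` masses of `Ỹ` (`‖s y κ‖ ≤ Cs·Σ_{σ,ν}(‖Ỹ(L•y+σ) ν‖² + ‖Ỹ(L•y+L•e_κ+σ) ν‖²)`, `Cs ≥ 0`); then for every centre `c` and
radius `R`, with `w_m := L·L⁻ᵈ + 2d·(210·α_m·((2d+2)L))`, `ρᵢ := Lⁱ(L+4) − 4`,
`Σ_{z∈box c R}Σ_κ‖Q n s z κ‖ ≤ (Π_{m<n}w_m)·(Cs·(2d·Σ_{x∈box (L^{n+1}•c) (L·(Lⁿ(R+4)−4) + 2L)}Σ_ν‖Ỹ x ν‖²)) + d·L·Σ_{i<n}(Π_{m<i}w_m)·Σ_{z∈box c R}Σ_κ(Σ_{x∈box (Lⁿ•z) ρᵢ}Σ_μ‖s x μ‖ + Σ_{x∈box (Lⁿ•(z+e κ)) ρᵢ}Σ_μ‖s x μ‖)`.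
«(O2) groundwork.» [cite: Balaban1985Averaging, (42)–(43) pp.23–24, (124)–(126) p.36] -/
theorem sum_norm_linTower_tied_le_boxes (L : ℕ) (hL : 2 ≤ L) (U₀ : Site d → Fin d → 𝔸ˣ) (n : ℕ)
    (hV : ∀ k, k ≤ n → ∀ (x : Site d) (μ : Fin d), avgIter L U₀ k x μ ∈ unitaryUnits 𝔸)
    (α : ℕ → ℝ) (hα0 : ∀ k, 0 ≤ α k)
    (hα : ∀ k, k < n → ∀ (z : Site d) (κ : Fin d) (r : Fin d → Fin L),
      ‖((Wcx L (avgIter L U₀ k) ((L : ℤ) • z) κ (boxVec L r) : 𝔸ˣ) : 𝔸) - 1‖ ≤ α k)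
    (hα24 : ∀ k, k < n → α k ≤ 1 / 24)
    (s : Site d → Fin d → 𝔸) (Q : ℕ → (Site d → Fin d → 𝔸) → Site d → Fin d → 𝔸) (hQ0 : Q 0 s = s)
    (hQs : ∀ (k : ℕ) (z : Site d) (κ : Fin d), Q (k + 1) s z κ
      = fderiv ℂ (eml : ((Fin d → Fin L) → 𝔸) → 𝔸) (fun r => ((Wcx L (avgIter L U₀ k) ((L : ℤ) • z) κ (boxVec L r) : 𝔸ˣ) : 𝔸))
            (fun r => tsum (avgIter L U₀ k) (Q k s) ((L : ℤ) • z) (gammaWord L κ (boxVec L r) ++ seg κ (-(L : ℤ)))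
              * ((Wcx L (avgIter L U₀ k) ((L : ℤ) • z) κ (boxVec L r) : 𝔸ˣ) : 𝔸))
            * (((expUnit (Xavg L (avgIter L U₀ k) ((L : ℤ) • z) κ))⁻¹ : 𝔸ˣ) : 𝔸)
          + ((expUnit (Xavg L (avgIter L U₀ k) ((L : ℤ) • z) κ) : 𝔸ˣ) : 𝔸) * tsum (avgIter L U₀ k) (Q k s) ((L : ℤ) • z) (seg κ (L : ℤ))
            * (((expUnit (Xavg L (avgIter L U₀ k) ((L : ℤ) • z) κ))⁻¹ : 𝔸ˣ) : 𝔸))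
    (Yt : Site d → Fin d → 𝔅) {Cs : ℝ} (hCs : 0 ≤ Cs)
    (hs : ∀ (y : Site d) (κ : Fin d), ‖s y κ‖ ≤ Cs * ∑ σ : Fin d → Fin L, ∑ ν : Fin d,
      (‖Yt ((L : ℤ) • y + boxVec L σ) ν‖ ^ 2 + ‖Yt ((L : ℤ) • y + (L : ℤ) • e κ + boxVec L σ) ν‖ ^ 2))
    (c : Site d) (R : ℤ) :
    ∑ z ∈ box c R, ∑ κ : Fin d, ‖Q n s z κ‖ ≤
      (∏ m ∈ Finset.range n, ((L : ℝ) * ((L : ℝ) ^ d)⁻¹ + 2 * d * (210 * α m * ((2 * d + 2) * L)))) *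
          (Cs * (2 * d * ∑ x ∈ box (((L : ℤ) ^ (n + 1)) • c) ((L : ℤ) * ((L : ℤ) ^ n * (R + 4) - 4) + 2 * L), ∑ ν : Fin d, ‖Yt x ν‖ ^ 2)) +
        d * L * ∑ i ∈ Finset.range n, (∏ m ∈ Finset.range i, ((L : ℝ) * ((L : ℝ) ^ d)⁻¹ + 2 * d * (210 * α m * ((2 * d + 2) * L)))) *
          ∑ z ∈ box c R, ∑ κ : Fin d,
            (∑ x ∈ box (((L : ℤ) ^ n) • z) ((L : ℤ) ^ i * (L + 4) - 4), ∑ μ : Fin d, ‖s x μ‖ +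
              ∑ x ∈ box (((L : ℤ) ^ n) • (z + e κ)) ((L : ℤ) ^ i * (L + 4) - 4), ∑ μ : Fin d, ‖s x μ‖) := by
  have hL1 : 1 ≤ L := le_trans (by norm_num) hL
  have h := sum_norm_linTower_le_boxes L hL U₀ n hV α hα0 hα hα24 s Q hQ0 hQs c R
  -- lift the straight box to `Ỹ`
  have h1 := sum_norm_tied_le_twoBlock_box L hL1 s (fun x ν => ‖Yt x ν‖ ^ 2) (fun _ _ => sq_nonneg _) hCs hs
    (((L : ℤ) ^ n) • c) ((L : ℤ) ^ n * (R + 4) - 4)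
  rw [smul_pow_smul] at h1
  have hw0 : 0 ≤ ∏ m ∈ Finset.range n, ((L : ℝ) * ((L : ℝ) ^ d)⁻¹ + 2 * d * (210 * α m * ((2 * d + 2) * L))) :=
    Finset.prod_nonneg fun m _ => by have := hα0 m; positivity
  exact h.trans (add_le_add (mul_le_mul_of_nonneg_left h1 hw0) le_rfl)

end Tied

end Summit.QuantumFields.YangMills.Theorems.Prop7CornerCombH21EPropagationTied

end
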